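import Summits.Ventures.PercRepro.MSTightCompletionCells
import Summits.Ventures.PercRepro.MSMinLostWithin
import Summits.Ventures.PercRepro.MSTightConjTSingCandidate

/-!
# Shape A of `SingCaseIResidue α`: every `r`-free member is C*-signable

Dossier proofs/MINE1-theoremS.md, Addendum 57 §3 and suppl. 4–8, Addendum 58; HANDOFF §mine-1
gen 32 → 33, step (K6). Setting: a residue instance `(F, u)` (`Residue F u`), `r ∈ u`, Case I
(`u₁ = u.erase r ∈ F`), a tight trace, some `r`-member without `r`-free partner, `univ.erase r ∉ F`,
and SHAPE A (`completion0 r F` tight). **Theorem** (`part0_sdiff_mem_diffsY_of_tight_completion0`):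
every `r`-free member `s` has `u₁ ∖ s ∈ Y` — the conclusion of `SingCaseIResidue α` in shape A.

Proof, in the coordinates of `MSTightCompletionCoords.lean` (`u₁ = (u_N, u_M)`, `x* = u_N` the
partnerless row of (ROW-a)): if `s₀ = (x₀, y₀)` had `u₁ ∖ s₀ ∉ Y`, then `(∅, y₀)` is not
C*-signable either (`Y` is a down-set), so it is A-signable: `ū_N ∈ L` and `M ∖ (y₀ ∩ u_M) ∈ U`.
The column `z = u_M ∖ y₀ ∈ M − U₀` is missing from the fibre of row `u_N`, so `u_N` is maximal in
`L`, `z` is LOST, and row `u_N` has exact excess `|U₀ ∖ K^{u_N}| = |Lost| + 1`. For a minimal lost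
`z′ ⊆ z`, the member `(∅, M ∖ z′)` is again A-signable, giving `ū_M ∪ z′ ∈ U`; `ū_M ∉ U₀` by
validity (row `ū_N ≠ u_N` is full); (A∩′) within `M` (`sdiff_mem_of_lost_within`) gives
`u_M ∖ z′ ∈ U₀`, and the members `(ū_N, u_M ∖ z′) ∪ r ∈ F` (row `ū_N` full) and
`(u_N, ū_M ∪ z′) ∈ P` are complementary — against validity.
-/

namespace PercRepro.MSTight

open Finset
open scoped FinsetFamily

variable {α : Type*} [DecidableEq α] [Fintype α] {F : Finset (Finset α)} {r : α} {u : Finset α}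

section Setup

/-- Every coordinate is `r`, in `N`, or in `M`. -/
theorem eq_or_mem_cN_or_mem_cM (a : α) :
    a = r ∨ a ∈ cN r F ∨ a ∈ cM r F := by
  by_cases har : a = r
  · exact Or.inl har
  by_cases haR : a ∈ Rstar (completion0 r F)
  · exact Or.inr (Or.inr (mem_erase.2 ⟨har, haR⟩))
  · exact Or.inr (Or.inl (mem_sdiff.2 ⟨mem_univ a, haR⟩))

/-- `N` is nonempty when `univ.erase r ∉ F` (else `(∅, M) = univ.erase r ∈ F₀`). -/
theorem cN_nonempty (htw : ∀ a b, Twin F a b → a = b) (hcore : ∀ a, ∃ t ∈ F, a ∉ t)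
    (hC : Tight (completion0 r F)) (hS : univ.erase r ∉ F) : (cN r F).Nonempty := by
  have hr : r ∈ Rstar (completion0 r F) := r_mem_Rstar_completion0 htw hcore
  by_contra hne
  rw [not_nonempty_iff_eq_empty] at hne
  have hM : cM r F = univ.erase r := by
    ext a
    rw [mem_erase]
    constructor
    · intro ha
      exact ⟨fun h => r_notMem_cM (h ▸ ha), mem_univ a⟩
    · rintro ⟨har, -⟩
      rcases eq_or_mem_cN_or_mem_cM a with h | h | h
      · exact absurd h har
      · rw [hne] at h
        exact absurd h (notMem_empty a)
      · exact h
  have := union_mem_part0 htw hcore hC (empty_mem_cL hcore) (cM_mem_cU0 hcore)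
  rw [empty_union, hM] at this
  exact hS (mem_part0.1 this).1

/-- `(N ∖ u) ∖ y = N ∖ u` for `y ⊆ M`. -/
theorem cN_sdiff_sdiff_eq {y : Finset α} (hy : y ⊆ cM r F) :
    (cN r F \ u) \ y = cN r F \ u := by
  apply sdiff_eq_left.2
  exact disjoint_of_subset_left sdiff_subset (disjoint_of_subset_right hy disjoint_cN_cM)

omit [Fintype α] in
/-- `a ∖ y = (a ∖ M) ∪ ((a ∩ M) ∖ y)` for `y ⊆ M`. -/
theorem sdiff_eq_sdiff_union_inter_sdiff {M a y : Finset α} (hy : y ⊆ M) :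
    a \ y = (a \ M) ∪ ((a ∩ M) \ y) := by
  ext x
  simp only [mem_sdiff, mem_union, mem_inter]
  constructor
  · rintro ⟨hxa, hxy⟩
    by_cases hxM : x ∈ M
    · exact Or.inr ⟨⟨hxa, hxM⟩, hxy⟩
    · exact Or.inl ⟨hxa, hxM⟩
  · rintro (⟨hxa, hxM⟩ | ⟨⟨hxa, -⟩, hxy⟩)
    · exact ⟨hxa, fun h => hxM (hy h)⟩
    · exact ⟨hxa, hxy⟩

end Setup

section ShapeA

/-- **Shape A of `SingCaseIResidue α`** (Addendum 57 suppl. 4–8, Addendum 58): in a residue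
instance with `r ∈ u`, `u.erase r ∈ F`, a tight trace, some `r`-member without `r`-free partner,
`univ.erase r ∉ F` and `completion0 r F` tight, every `r`-free member `s` has `u.erase r ∖ s ∈ Y`. -/
theorem part0_sdiff_mem_diffsY_of_tight_completion0 (hR : Residue F u) (hP : Tight (proj r F))
    (hru : r ∈ u) (hu1 : u.erase r ∈ F) (hrem : ¬ partr r F ⊆ part0 r F) (hS : univ.erase r ∉ F)
    (hC : Tight (completion0 r F)) : ∀ s ∈ part0 r F, u.erase r \ s ∈ diffsY r F := by
  intro s₀ hs₀
  by_contra hw₀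
  have htw := hR.htf
  have hF := hR.hexc
  have hE := hR.hempty
  have hU := hR.huniv
  have hcore := hR.hcore
  have hsupp := hR.hsupp
  have hr : r ∈ Rstar (completion0 r F) := r_mem_Rstar_completion0 htw hcore
  have hU₁ : (cU r F \ cU0 r F).Nonempty := cU_sdiff_cU0_nonempty htw hcore hC hrem
  have hUM : ∀ y ∈ cU r F, y ⊆ cM r F := fun _ hy => subset_cM_of_mem_cU hy
  have hUup := isUpSetWithin_cU htw hcore hC
  have hU0up := isUpSetWithin_cU0 htw hcore hC
  have hU0U := cU0_subset_cU htw hcore hC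
  -- the near member `u₁ = (u_N, u_M)`, partnerless
  have hu₁ : u.erase r ∈ part0 r F := mem_part0.2 ⟨hu1, notMem_erase r u⟩
  have hu₁K : u.erase r ∉ partner r F := by
    intro h
    have := (mem_partr.1 (inter_subset_right h)).2
    rw [insert_erase hru] at this
    exact hR.hu this
  have huN : u.erase r \ cM r F ∈ cL r F :=
    sdiff_cM_mem_cL_of_mem_proj htw hcore hC (mem_proj_of_mem_part0 hu₁)
  have huM : u.erase r ∩ cM r F ∈ cU0 r F := inter_cM_mem_cU0_of_mem_part0 htw hcore hC hu₁
  have huMU : u.erase r ∩ cM r F ∈ cU r F := hU0U huM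
  -- `Y` is a down-set
  have hYdown : ∀ y ∈ diffsY r F, ∀ z ⊆ y, z ∈ diffsY r F := fun y hy z hz =>
    mem_diffsY_of_subset_of_genuine htw hF hE hU hcore hsupp hy hz
  -- the column member `(∅, y₀)`
  set y₀ := s₀ ∩ cM r F with hy₀def
  have hy₀ : y₀ ∈ cU0 r F := inter_cM_mem_cU0_of_mem_part0 htw hcore hC hs₀
  have hy₀M : y₀ ⊆ cM r F := subset_cM_of_mem_cU0 hy₀
  have hs₁ : y₀ ∈ part0 r F := by
    have := union_mem_part0 htw hcore hC (empty_mem_cL hcore) hy₀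
    rwa [empty_union] at this
  have hw₁ : u.erase r \ y₀ ∉ diffsY r F := fun h =>
    hw₀ (hYdown _ h _ (sdiff_subset_sdiff (Subset.refl _) inter_subset_left))
  have hA₁ : Cells (F \\ F) y₀ u := by
    rcases hR.hsig y₀ (mem_part0.1 hs₁).1 with h | h
    · exact h
    · exact absurd ((cells_compl_iff_of_mem_part0 htw hF hE hU hcore hsupp hP hC hru hu1 hs₁).1 h)
        hw₁
  -- `ū_N ∈ L`
  have hūN : cN r F \ u ∈ cL r F := by
    have := cL_of_cells htw hF hE hU hcore hsupp hP hC hru hA₁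
    rwa [cN_sdiff_sdiff_eq hy₀M] at this
  -- the missing column `z = u_M ∖ y₀`
  set z := (u.erase r ∩ cM r F) \ y₀ with hzdef
  have hzM : z ⊆ cM r F := sdiff_subset.trans inter_subset_right
  have hz : z ∈ complWithin (cM r F) (cU0 r F) := by
    rw [mem_complWithin_iff (fun _ hy => subset_cM_of_mem_cU0 hy) hzM]
    refine hU0up _ hy₀ _ sdiff_subset fun a ha => ?_
    exact mem_sdiff.2 ⟨hy₀M ha, fun h => (mem_sdiff.1 h).2 ha⟩
  have hsplit : u.erase r \ y₀ = (u.erase r \ cM r F) ∪ z := sdiff_eq_sdiff_union_inter_sdiff hy₀M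
  have hzY : z ∉ fibre (cM r F) (diffsY r F) (u.erase r \ cM r F) := by
    intro h
    apply hw₁
    rw [hsplit]
    exact (mem_fibre.1 h).2
  -- row `u_N` is maximal, `z` is lost, exact excess
  have hmax := maximal_of_notMem_fibre htw hF hE hU hcore hsupp hP hC hrem hu₁ hu₁K hz hzY
  set T := fibre (cM r F) (partner r F) (u.erase r \ cM r F) with hTdef
  have hzL : z ∈ lostWithin (cM r F) (cU r F) (cU0 r F) T :=
    mem_lostWithin_of_notMem_fibre htw hcore hC huN hmax hz hzY
  have hexact := card_sdiff_eq_card_lostWithin_add_one htw hF hE hU hcore hsupp hP hC hrem hu₁ hu₁K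
    hmax
  -- a minimal lost set `z′ ⊆ z`
  obtain ⟨z', hz', hmin⟩ := exists_min_image
    ((lostWithin (cM r F) (cU r F) (cU0 r F) T).filter fun w => w ⊆ z) card
    ⟨z, mem_filter.2 ⟨hzL, Subset.refl z⟩⟩
  obtain ⟨hz'L, hz'z⟩ := mem_filter.1 hz'
  have hz'min : ∀ w ∈ lostWithin (cM r F) (cU r F) (cU0 r F) T, w ⊆ z' → w = z' := by
    intro w hw hwz'
    exact eq_of_subset_of_card_le hwz' (hmin w (mem_filter.2 ⟨hw, hwz'.trans hz'z⟩))
  have hz'M : z' ⊆ cM r F := hz'z.trans hzM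
  have hz'uM : z' ⊆ u.erase r ∩ cM r F := hz'z.trans sdiff_subset
  -- the member `(∅, M ∖ z′)` is A-signable: `ū_M ∪ z′ ∈ U`
  have hMz' : cM r F \ z' ∈ cU0 r F := by
    rw [← mem_complWithin_iff (fun _ hy => subset_cM_of_mem_cU0 hy) hz'M]
    exact lostWithin_subset hz'L
  have hs₂ : cM r F \ z' ∈ part0 r F := by
    have := union_mem_part0 htw hcore hC (empty_mem_cL hcore) hMz'
    rwa [empty_union] at this
  have hw₂ : u.erase r \ (cM r F \ z') ∉ diffsY r F := by
    intro h
    have hz'Y : z' ∈ fibre (cM r F) (diffsY r F) (u.erase r \ cM r F) := by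
      refine mem_fibre.2 ⟨hz'M, ?_⟩
      have e : u.erase r \ (cM r F \ z') = (u.erase r \ cM r F) ∪ z' := by
        ext a
        simp only [mem_sdiff, mem_union, not_and, not_not]
        constructor
        · rintro ⟨hau, h⟩
          by_cases haM : a ∈ cM r F
          · exact Or.inr (h haM)
          · exact Or.inl ⟨hau, haM⟩
        · rintro (⟨hau, haM⟩ | haz')
          · exact ⟨hau, fun h => absurd h haM⟩
          · exact ⟨(mem_inter.1 (hz'uM haz')).1, fun _ => haz'⟩
      rw [← e]
      exact h
    rw [fibre_diffsY_eq_sdiff_lostWithin_of_maximal htw hcore hC huN hmax, mem_sdiff] at hz'Y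
    exact hz'Y.2 hz'L
  have hA₂ : Cells (F \\ F) (cM r F \ z') u := by
    rcases hR.hsig _ (mem_part0.1 hs₂).1 with h | h
    · exact h
    · exact absurd ((cells_compl_iff_of_mem_part0 htw hF hE hU hcore hsupp hP hC hru hu1 hs₂).1 h)
        hw₂
  have hg : (cM r F \ (u.erase r ∩ cM r F)) ∪ z' ∈ cU r F := by
    have := cU_of_cells htw hF hE hU hcore hsupp hP hC (fun h => r_notMem_cM (mem_sdiff.1 h).1) hA₂
    have e : cM r F \ ((cM r F \ z') ∩ u) = (cM r F \ (u.erase r ∩ cM r F)) ∪ z' := by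
      ext a
      rw [mem_sdiff, mem_inter, mem_sdiff, mem_union, mem_sdiff, mem_inter, mem_erase]
      constructor
      · rintro ⟨haM, h⟩
        by_cases haz' : a ∈ z'
        · exact Or.inr haz'
        · exact Or.inl ⟨haM, fun h2 => h ⟨⟨haM, haz'⟩, h2.1.2⟩⟩
      · rintro (⟨haM, h⟩ | haz')
        · exact ⟨haM, fun h2 => h ⟨⟨fun har => r_notMem_cM (har ▸ haM), h2.2⟩, haM⟩⟩
        · exact ⟨hz'M haz', fun h2 => h2.1.2 haz'⟩
    rwa [e] at this
  -- `ū_M ∉ U₀`: validity at `u₁`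
  have hūNne : cN r F \ u ≠ u.erase r \ cM r F := by
    intro h
    obtain ⟨a, ha⟩ := cN_nonempty htw hcore hC hS
    have har : a ≠ r := fun h' => r_notMem_cN hr (h' ▸ ha)
    have haM : a ∉ cM r F := disjoint_left.1 disjoint_cN_cM ha
    by_cases hau : a ∈ u
    · have : a ∈ cN r F \ u := by
        rw [h]
        exact mem_sdiff.2 ⟨mem_erase.2 ⟨har, hau⟩, haM⟩
      exact (mem_sdiff.1 this).2 hau
    · have : a ∈ u.erase r \ cM r F := by
        rw [← h]
        exact mem_sdiff.2 ⟨ha, hau⟩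
      exact hau (mem_erase.1 (mem_sdiff.1 this).1).2
  have hnot : cM r F \ (u.erase r ∩ cM r F) ∉ cU0 r F := by
    intro hūM
    have hk : (cN r F \ u) ∪ (cM r F \ (u.erase r ∩ cM r F)) ∈ partner r F :=
      union_mem_partner_of_ne htw hF hE hU hcore hsupp hP hC hrem hu₁ hu₁K hūN hūNne hūM
    have hmem := (mem_partr.1 (inter_subset_right hk)).2
    have e : insert r ((cN r F \ u) ∪ (cM r F \ (u.erase r ∩ cM r F))) = univ \ u.erase r := by
      ext a
      constructor
      · intro h
        refine mem_sdiff.2 ⟨mem_univ a, fun h' => ?_⟩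
        obtain ⟨har, hau⟩ := mem_erase.1 h'
        rcases mem_insert.1 h with h | h
        · exact har h
        · rcases mem_union.1 h with h | h
          · exact (mem_sdiff.1 h).2 hau
          · exact (mem_sdiff.1 h).2 (mem_inter.2 ⟨h', (mem_sdiff.1 h).1⟩)
      · intro h
        have h' := (mem_sdiff.1 h).2
        by_cases har : a = r
        · exact mem_insert.2 (Or.inl har)
        · have hau : a ∉ u := fun hau => h' (mem_erase.2 ⟨har, hau⟩)
          rcases eq_or_mem_cN_or_mem_cM a with h'' | h'' | h''
          · exact absurd h'' har
          · exact mem_insert.2 (Or.inr (mem_union_left _ (mem_sdiff.2 ⟨h'', hau⟩)))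
          · exact mem_insert.2 (Or.inr (mem_union_right _
              (mem_sdiff.2 ⟨h'', fun h3 => hau (mem_erase.1 (mem_inter.1 h3).1).2⟩)))
    rw [e] at hmem
    exact hR.hvalid _ hu1 hmem
  -- (A∩′) within `M`: `u_M ∖ z′ ∈ U₀`
  have hAcap : (u.erase r ∩ cM r F) \ z' ∈ cU0 r F :=
    sdiff_mem_of_lost_within hUM hUup hU0up hU0U hU₁ hexact hz'L hz'min huMU hz'uM hg hnot
  -- the complementary pair
  have hk : (cN r F \ u) ∪ ((u.erase r ∩ cM r F) \ z') ∈ partner r F :=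
    union_mem_partner_of_ne htw hF hE hU hcore hsupp hP hC hrem hu₁ hu₁K hūN hūNne hAcap
  have hkF : insert r ((cN r F \ u) ∪ ((u.erase r ∩ cM r F) \ z')) ∈ F :=
    (mem_partr.1 (inter_subset_right hk)).2
  have hp : (u.erase r \ cM r F) ∪ ((cM r F \ (u.erase r ∩ cM r F)) ∪ z') ∈ proj r F :=
    union_mem_proj htw hcore hC huN hg
  have ecompl : univ \ insert r ((cN r F \ u) ∪ ((u.erase r ∩ cM r F) \ z')) =
      (u.erase r \ cM r F) ∪ ((cM r F \ (u.erase r ∩ cM r F)) ∪ z') := by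
    ext a
    by_cases har : a = r
    · subst har
      constructor
      · intro h
        exact absurd (mem_insert_self a _) (mem_sdiff.1 h).2
      · intro h
        rcases mem_union.1 h with h | h
        · exact absurd rfl (mem_erase.1 (mem_sdiff.1 h).1).1
        · rcases mem_union.1 h with h | h
          · exact (r_notMem_cM (mem_sdiff.1 h).1).elim
          · exact (r_notMem_cM (hz'M h)).elim
    · rcases eq_or_mem_cN_or_mem_cM a with h' | h' | h'
      · exact absurd h' har
      · have haM : a ∉ cM r F := disjoint_left.1 disjoint_cN_cM h'
        have haz' : a ∉ z' := fun h => haM (hz'M h)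
        constructor
        · intro h
          have h2 := (mem_sdiff.1 h).2
          rw [mem_insert, mem_union, not_or, not_or] at h2
          obtain ⟨-, h3, -⟩ := h2
          have hau : a ∈ u := by
            by_contra hau
            exact h3 (mem_sdiff.2 ⟨h', hau⟩)
          exact mem_union_left _ (mem_sdiff.2 ⟨mem_erase.2 ⟨har, hau⟩, haM⟩)
        · intro h
          have hau : a ∈ u := by
            rcases mem_union.1 h with h | h
            · exact (mem_erase.1 (mem_sdiff.1 h).1).2
            · rcases mem_union.1 h with h | h
              · exact absurd (mem_sdiff.1 h).1 haM
              · exact absurd h haz'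
          refine mem_sdiff.2 ⟨mem_univ a, ?_⟩
          rw [mem_insert, mem_union, not_or, not_or]
          exact ⟨har, fun h => (mem_sdiff.1 h).2 hau,
            fun h => haM (inter_subset_right (mem_sdiff.1 h).1)⟩
      · have haN : a ∉ cN r F := disjoint_right.1 disjoint_cN_cM h'
        constructor
        · intro h
          have h2 := (mem_sdiff.1 h).2
          rw [mem_insert, mem_union, not_or, not_or] at h2
          obtain ⟨-, -, h3⟩ := h2
          refine mem_union_right _ ?_
          by_cases haz' : a ∈ z'
          · exact mem_union_right _ haz'
          · exact mem_union_left _ (mem_sdiff.2 ⟨h', fun hauM => h3 (mem_sdiff.2 ⟨hauM, haz'⟩)⟩)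
        · intro h
          refine mem_sdiff.2 ⟨mem_univ a, ?_⟩
          rw [mem_insert, mem_union, not_or, not_or]
          refine ⟨har, fun h'' => haN (mem_sdiff.1 h'').1, fun h'' => ?_⟩
          obtain ⟨hauM, haz'⟩ := mem_sdiff.1 h''
          rcases mem_union.1 h with h | h
          · exact (mem_sdiff.1 h).2 h'
          · rcases mem_union.1 h with h | h
            · exact (mem_sdiff.1 h).2 hauM
            · exact haz' h
  rw [proj_eq_union, mem_union] at hp
  rcases hp with hp | hp
  · -- `p ∈ F` is the complement of `insert r k ∈ F`
    apply hR.hvalid _ hkF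
    rw [ecompl]
    exact (mem_part0.1 hp).1
  · -- `insert r p ∈ F` is the complement of `k ∈ F`
    have hpF := (mem_partr.1 hp).2
    apply hR.hvalid _ hpF
    have hrk : r ∉ (cN r F \ u) ∪ ((u.erase r ∩ cM r F) \ z') := by
      rw [mem_union, not_or]
      exact ⟨fun h => r_notMem_cN hr (mem_sdiff.1 h).1,
        fun h => r_notMem_cM (mem_inter.1 (mem_sdiff.1 h).1).2⟩
    have e2 : insert r (univ \ insert r ((cN r F \ u) ∪ ((u.erase r ∩ cM r F) \ z'))) =
        univ \ ((cN r F \ u) ∪ ((u.erase r ∩ cM r F) \ z')) := by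
      ext a
      rw [mem_insert, mem_sdiff, mem_sdiff, mem_insert, and_iff_right (mem_univ a),
        and_iff_right (mem_univ a), not_or]
      constructor
      · rintro (rfl | ⟨-, h⟩)
        · exact hrk
        · exact h
      · intro h
        by_cases har : a = r
        · exact Or.inl har
        · exact Or.inr ⟨har, h⟩
    have : univ \ insert r ((u.erase r \ cM r F) ∪ ((cM r F \ (u.erase r ∩ cM r F)) ∪ z')) =
        (cN r F \ u) ∪ ((u.erase r ∩ cM r F) \ z') := by
      rw [← ecompl, e2, Finset.sdiff_sdiff_eq_self (subset_univ _)]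
    rw [this]
    exact (mem_part0.1 (inter_subset_left hk)).1

end ShapeA

end PercRepro.MSTight
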